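import Literature.Probability.Percolation.IsoradialCriticalityProofs
import Literature.Probability.Percolation.IsoradialProofs
import Literature.Probability.LatticeModels.MeshLoops
import HarnessLib

/-!
# Planarity of rhombic tilings, I: diagonals, corners and the straight-line drawing

Topic `Literature/Probability/Percolation`; theorems only. Let `emb : RhombicEmbedding G F` be
isoradial (`IsIsoradial`) and satisfy the tiling condition (`IsRhombicTiling`: rhombi of
distinct edges have disjoint interiors, the rhombi cover the plane, face centres are distinct).
Grimmett–Manolescu (*Bond percolation on isoradial graphs*, PTRF 159 (2014) = arXiv:1204.0505,
§4.1) use throughout that the diamond graph `G^◇` is then a *planar* tiling: "The pair `e`,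
`e*` are diagonals of the same rhombus of `G^◇` and are thus perpendicular", the primal graph
`G` and its dual are plane graphs drawn with straight edges, open primal paths and open dual
paths do not cross, etc. In the tree these consequences have to be *derived* from the three
clauses of `IsRhombicTiling`; this file proves the part that follows from convex geometry and
the disjointness of interiors alone:

* plane geometry of a quadrilateral `A P B Q` with `P + Q = A + B` (and unit sides):
  `mem_convexHull_quad_of_abs_add_abs_le` (the point `M + s a + t p`, `|s| + |t| ≤ 1`, of the
  rhombus with centre `M`, half-diagonals `a`, `p`, lies in `conv{A, P, B, Q}`),
  `ball_subset_convexHull_quad` (an open disc about every point with `|s| + |t| < 1`),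
  `openSegment_subset_interior_convexHull_quad` (open diagonals lie in the interior),
  `not_mem_interior_convexHull_quad` (a corner is not an interior point);
* for the embedding: `openSegment_z_subset_interior_rhombus`,
  `openSegment_c_subset_interior_rhombus` (the open primal / dual diagonal of an edge lies in
  the interior of its rhombus), `z_not_mem_interior_rhombus`, `c_not_mem_interior_rhombus`
  (**no vertex and no face centre is an interior point of any rhombus** — tiling condition),
  and the **plane-drawing property** `segment_z_inter_segment_z_subset` (the closed straight
  edges of two distinct edges of `G` meet only at the position of a common endpoint),
  `segment_c_inter_segment_c_subset` (the same for dual edges),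
  `segment_z_inter_segment_c_subset` (a primal edge and the dual edge of a *different* rhombus
  can only meet at a point that is simultaneously a vertex position of the one and a face-centre
  position of the other).

What is deliberately NOT here. The last statement cannot be improved to "do not meet" from
`IsIsoradial ∧ IsRhombicTiling` alone: relabelling, in a genuine rhombic tiling, the rhombi of
a half-plane by exchanging the roles of primal and dual corners produces data satisfying both
predicates in which a vertex position coincides with a face-centre position (and `G` is
disconnected); likewise a tiling by rows of squares shifted by half a unit satisfies both
predicates with T-junctions. Excluding such configurations needs `G.Preconnected` and a global
argument (parity of the corner graph / de Bruijn's train tracks), which is the subject of a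
sequel. These facts are prerequisites of the duality and gluing steps in any formalization of
Grimmett–Manolescu's box-crossing theorem (tree fact `gm_boxCrossingBounds_uniform`).

## References

* G. R. Grimmett, I. Manolescu, *Bond percolation on isoradial graphs: criticality and
  universality*, PTRF 159 (2014) 273–327, arXiv:1204.0505, §2.1 and §4.1.
* R. Kenyon, J.-M. Schlenker, *Rhombic embeddings of planar quad-graphs*, Trans. AMS 357 (2005),
  §1 and Thm 3.1.
-/

noncomputable section

namespace Literature.Probability.Percolation

open Complex ComplexConjugate Metric Set
open Literature.Probability.LatticeModels IsoradialCriticality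

/-! ### Plane geometry of the quadrilateral `A P B Q` -/

section Quad

variable {A B P Q : ℂ}

/-- The four corners lie in their convex hull. [folklore] -/
theorem corners_mem_convexHull_quad (A P B Q : ℂ) :
    A ∈ convexHull ℝ ({A, P, B, Q} : Set ℂ) ∧ P ∈ convexHull ℝ ({A, P, B, Q} : Set ℂ) ∧
      B ∈ convexHull ℝ ({A, P, B, Q} : Set ℂ) ∧ Q ∈ convexHull ℝ ({A, P, B, Q} : Set ℂ) :=
  ⟨subset_convexHull ℝ _ (by simp), subset_convexHull ℝ _ (by simp),
    subset_convexHull ℝ _ (by simp), subset_convexHull ℝ _ (by simp)⟩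

/-- **Diagonal coordinates.** In a quadrilateral `A P B Q` whose diagonals bisect each other
(`P + Q = A + B`; centre `M = (A + B)/2`, half-diagonals `a = (A - B)/2`, `p = (P - Q)/2`) the
point `M + s a + t p` with `|s| + |t| ≤ 1` lies in `conv{A, P, B, Q}`: it is the convex
combination with weights `(1 ± 2s + |s| - |t|)/4` of `A, B` and `(1 ± 2t + |t| - |s|)/4` of
`P, Q` (the computation of `IsoradialCriticality.ball_subset_convexHull_rhombus`, isolated).
[folklore] -/
theorem mem_convexHull_quad_of_abs_add_abs_le (hsum : P + Q = A + B) (s t : ℝ)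
    (hst : |s| + |t| ≤ 1) :
    (A + B) / 2 + (s : ℂ) * ((A - B) / 2) + (t : ℂ) * ((P - Q) / 2) ∈
      convexHull ℝ ({A, P, B, Q} : Set ℂ) := by
  obtain ⟨hAin, hPin, hBin, hQin⟩ := corners_mem_convexHull_quad A P B Q
  set lA : ℝ := (1 + 2 * s + |s| - |t|) / 4 with hlA
  set lB : ℝ := (1 - 2 * s + |s| - |t|) / 4 with hlB
  set lP : ℝ := (1 + 2 * t + |t| - |s|) / 4 with hlP
  set lQ : ℝ := (1 - 2 * t + |t| - |s|) / 4 with hlQ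
  have hlA0 : 0 ≤ lA := by
    simp only [hlA]; linarith [neg_abs_le s, le_abs_self s, abs_nonneg t]
  have hlB0 : 0 ≤ lB := by
    simp only [hlB]; linarith [neg_abs_le s, le_abs_self s, abs_nonneg t]
  have hlP0 : 0 ≤ lP := by
    simp only [hlP]; linarith [neg_abs_le t, le_abs_self t, abs_nonneg s]
  have hlQ0 : 0 ≤ lQ := by
    simp only [hlQ]; linarith [neg_abs_le t, le_abs_self t, abs_nonneg s]
  have hconv : Convex ℝ (convexHull ℝ ({A, P, B, Q} : Set ℂ)) := convex_convexHull ℝ _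
  have key : lA • A + lP • P + lB • B + lQ • Q ∈ convexHull ℝ ({A, P, B, Q} : Set ℂ) := by
    have h := hconv.sum_mem (t := Finset.univ) (w := ![lA, lP, lB, lQ]) (z := ![A, P, B, Q])
      (by intro i _; fin_cases i <;> simp [hlA0, hlB0, hlP0, hlQ0])
      (by simp [Fin.sum_univ_four]; simp only [hlA, hlB, hlP, hlQ]; ring)
      (by intro i _; fin_cases i <;> simp [hAin, hPin, hBin, hQin])
    simpa [Fin.sum_univ_four] using h
  have hw_eq : (A + B) / 2 + (s : ℂ) * ((A - B) / 2) + (t : ℂ) * ((P - Q) / 2) =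
      lA • A + lP • P + lB • B + lQ • Q := by
    simp only [Complex.real_smul, hlA, hlB, hlP, hlQ]
    push_cast
    linear_combination (-(1 + |t| - |s|) / 4 : ℂ) * hsum
  rw [hw_eq]
  exact key

/-- **A disc about every inner point.** For a non-degenerate rhombus `A P B Q` with unit sides
(`P + Q = A + B`, `A ≠ B`, `P ≠ Q`, `‖A - P‖ = ‖B - P‖ = 1`) and `|s| + |t| < 1`, the open disc
about `M + s a + t p` of radius `(1 - |s| - |t|) ‖a‖ ‖p‖` lies in `conv{A, P, B, Q}`
(homothety of ratio `1 - |s| - |t|` of the inscribed disc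
`IsoradialCriticality.ball_subset_convexHull_rhombus` towards the boundary point in the
direction of `(s, t)`). [folklore] -/
theorem ball_subset_convexHull_quad (hsum : P + Q = A + B) (hAB : A ≠ B) (hPQ : P ≠ Q)
    (hAP : ‖A - P‖ = 1) (hBP : ‖B - P‖ = 1) {s t : ℝ} (hst : |s| + |t| < 1) :
    ball ((A + B) / 2 + (s : ℂ) * ((A - B) / 2) + (t : ℂ) * ((P - Q) / 2))
        ((1 - (|s| + |t|)) * (‖(A - B) / 2‖ * ‖(P - Q) / 2‖)) ⊆
      convexHull ℝ ({A, P, B, Q} : Set ℂ) := by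
  set a : ℂ := (A - B) / 2 with ha
  set p : ℂ := (P - Q) / 2 with hp
  set M : ℂ := (A + B) / 2 with hM
  set K : Set ℂ := convexHull ℝ ({A, P, B, Q} : Set ℂ) with hK
  set lam : ℝ := |s| + |t| with hlam
  have hball : ball M (‖a‖ * ‖p‖) ⊆ K := ball_subset_convexHull_rhombus hsum hAB hPQ hAP hBP
  have hconv : Convex ℝ K := convex_convexHull ℝ _
  have hlam0 : 0 ≤ lam := by positivity
  have hlam1 : lam < 1 := hst
  intro Z hZ
  rw [mem_ball, dist_eq_norm] at hZ
  rcases hlam0.eq_or_lt with hl0 | hl0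
  · -- `s = t = 0`: the inscribed disc itself
    have hs0 : s = 0 := by
      have : |s| = 0 := by linarith [abs_nonneg s, abs_nonneg t]
      exact abs_eq_zero.1 this
    have ht0 : t = 0 := by
      have : |t| = 0 := by linarith [abs_nonneg s, abs_nonneg t]
      exact abs_eq_zero.1 this
    apply hball
    rw [mem_ball, dist_eq_norm]
    simp only [hs0, ht0, Complex.ofReal_zero, zero_mul, add_zero, ← hl0, sub_zero,
      one_mul] at hZ
    exact hZ
  · -- homothety: `X = (1 - λ) M + λ Y` with `Y` on the boundary in the direction `(s, t)`
    set Y : ℂ := M + ((s / lam : ℝ) : ℂ) * a + ((t / lam : ℝ) : ℂ) * p with hY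
    have hYK : Y ∈ K := by
      apply mem_convexHull_quad_of_abs_add_abs_le hsum
      rw [abs_div, abs_div, abs_of_pos hl0, ← add_div, div_le_one hl0]
    set X : ℂ := M + (s : ℂ) * a + (t : ℂ) * p with hX
    have hXY : X = ((1 - lam : ℝ) : ℂ) * M + (lam : ℂ) * Y := by
      simp only [hX, hY]
      have hl : (lam : ℂ) ≠ 0 := by exact_mod_cast hl0.ne'
      push_cast
      field_simp
      ring
    set M' : ℂ := M + (Z - X) / ((1 - lam : ℝ) : ℂ) with hM'
    have h1l : (0 : ℝ) < 1 - lam := by linarith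
    have hM'K : M' ∈ K := by
      apply hball
      rw [mem_ball, dist_eq_norm]
      have : M' - M = (Z - X) / ((1 - lam : ℝ) : ℂ) := by rw [hM']; ring
      rw [this, norm_div, Complex.norm_real, Real.norm_eq_abs, abs_of_pos h1l,
        div_lt_iff₀ h1l]
      calc ‖Z - X‖ < (1 - lam) * (‖a‖ * ‖p‖) := hZ
        _ = ‖a‖ * ‖p‖ * (1 - lam) := by ring
    have hZeq : Z = (1 - lam) • M' + lam • Y := by
      simp only [Complex.real_smul, hM']
      have hl : ((1 - lam : ℝ) : ℂ) ≠ 0 := by exact_mod_cast h1l.ne'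
      have : Z = X + (Z - X) := by ring
      rw [this, hXY]
      push_cast at hl ⊢
      field_simp
      ring
    rw [hZeq]
    exact hconv hM'K hYK h1l.le hlam0 (by ring)

/-- A point of `ball`-interior type: if an open disc about `x` lies in `K` then `x ∈ interior K`.
[folklore] -/
theorem mem_interior_of_ball_subset {K : Set ℂ} {x : ℂ} {r : ℝ} (hr : 0 < r)
    (h : ball x r ⊆ K) : x ∈ interior K :=
  mem_interior.2 ⟨ball x r, h, isOpen_ball, mem_ball_self hr⟩

/-- **Open diagonals are interior.** In a non-degenerate rhombus with unit sides the open
diagonal `(A, B)` lies in the interior of `conv{A, P, B, Q}`. [folklore] -/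
theorem openSegment_subset_interior_convexHull_quad (hsum : P + Q = A + B) (hAB : A ≠ B)
    (hPQ : P ≠ Q) (hAP : ‖A - P‖ = 1) (hBP : ‖B - P‖ = 1) :
    openSegment ℝ A B ⊆ interior (convexHull ℝ ({A, P, B, Q} : Set ℂ)) := by
  intro X hX
  rw [openSegment_eq_image] at hX
  obtain ⟨θ, ⟨hθ0, hθ1⟩, rfl⟩ := hX
  change (1 - θ) • A + θ • B ∈ interior (convexHull ℝ ({A, P, B, Q} : Set ℂ))
  -- `(1 - θ) A + θ B = M + s a` with `s = 1 - 2θ ∈ (-1, 1)`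
  set s : ℝ := 1 - 2 * θ with hs
  have hs1 : |s| + |(0 : ℝ)| < 1 := by
    rw [abs_zero, add_zero, abs_lt]; constructor <;> simp only [hs] <;> linarith
  have hXeq : (1 - θ) • A + θ • B =
      (A + B) / 2 + (s : ℂ) * ((A - B) / 2) + ((0 : ℝ) : ℂ) * ((P - Q) / 2) := by
    simp only [Complex.real_smul, hs]
    push_cast
    ring
  have hr : 0 < (1 - (|s| + |0|)) * (‖(A - B) / 2‖ * ‖(P - Q) / 2‖) := by
    have ha : 0 < ‖(A - B) / 2‖ := by
      rw [norm_pos_iff]; intro h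
      rcases div_eq_zero_iff.1 h with h | h
      · exact hAB (sub_eq_zero.1 h)
      · norm_num at h
    have hp : 0 < ‖(P - Q) / 2‖ := by
      rw [norm_pos_iff]; intro h
      rcases div_eq_zero_iff.1 h with h | h
      · exact hPQ (sub_eq_zero.1 h)
      · norm_num at h
    have : 0 < 1 - (|s| + |(0:ℝ)|) := by linarith
    positivity
  rw [hXeq]
  exact mem_interior_of_ball_subset hr (ball_subset_convexHull_quad hsum hAB hPQ hAP hBP hs1)

/-- **A corner is not an interior point.** In a rhombus `A P B Q` with unit sides and `A ≠ B`
the corner `A` is not in the interior of `conv{A, P, B, Q}`: the linear functional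
`X ↦ Re((X - M) ā)` is at most `‖a‖²` on the four corners (it vanishes at `P, Q` because the
diagonals are perpendicular), hence on the hull, while it exceeds `‖a‖²` at `A + δ a`, `δ > 0`.
[folklore] -/
theorem not_mem_interior_convexHull_quad (hsum : P + Q = A + B) (hAB : A ≠ B)
    (hAP : ‖A - P‖ = 1) (hBP : ‖B - P‖ = 1) :
    A ∉ interior (convexHull ℝ ({A, P, B, Q} : Set ℂ)) := by
  obtain ⟨-, horth⟩ := rhombus_halfDiag hsum hAP hBP
  set a : ℂ := (A - B) / 2 with ha
  set p : ℂ := (P - Q) / 2 with hp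
  set M : ℂ := (A + B) / 2 with hM
  have ha0 : a ≠ 0 := by
    simp only [ha]; intro h
    rcases div_eq_zero_iff.1 h with h | h
    · exact hAB (sub_eq_zero.1 h)
    · norm_num at h
  -- the functional and the half-plane
  let ℓ : ℂ → ℝ := fun X => ((X - M) * conj a).re
  have hℓ_lin : ∀ (X Y : ℂ) (u v : ℝ), u + v = 1 → ℓ (u • X + v • Y) = u * ℓ X + v * ℓ Y := by
    intro X Y u v huv
    simp only [ℓ, Complex.real_smul]
    have : ((u : ℂ) * X + (v : ℂ) * Y - M) * conj a =
        (u : ℂ) * ((X - M) * conj a) + (v : ℂ) * ((Y - M) * conj a) := by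
      have hu : (u : ℂ) + (v : ℂ) = 1 := by exact_mod_cast huv
      linear_combination (M * conj a) * hu
    rw [this, Complex.add_re, Complex.re_ofReal_mul, Complex.re_ofReal_mul]
  have hH : Convex ℝ {X : ℂ | ℓ X ≤ normSq a} := by
    intro X hX Y hY u v hu hv huv
    simp only [mem_setOf_eq] at hX hY ⊢
    rw [hℓ_lin X Y u v huv]
    have h1 := mul_le_mul_of_nonneg_left hX hu
    have h2 := mul_le_mul_of_nonneg_left hY hv
    have h3 : u * normSq a + v * normSq a = normSq a := by rw [← add_mul, huv, one_mul]
    linarith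
  have hAa : A - M = a := by simp only [ha, hM]; ring
  have hBa : B - M = -a := by simp only [ha, hM]; ring
  have hPa : P - M = p := by simp only [hp, hM]; linear_combination (1 / 2 : ℂ) * hsum
  have hQa : Q - M = -p := by simp only [hp, hM]; linear_combination (1 / 2 : ℂ) * hsum
  have hpa : (p * conj a).re = 0 := by
    have : (p * conj a).re = (a * conj p).re := by
      simp [Complex.mul_re, Complex.conj_re, Complex.conj_im]; ring
    rw [this]; exact horth
  have hℓA : ℓ A = normSq a := by simp only [ℓ, hAa, Complex.mul_conj, Complex.ofReal_re]
  have hℓB : ℓ B = -normSq a := by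
    simp only [ℓ, hBa, neg_mul, Complex.neg_re, Complex.mul_conj, Complex.ofReal_re]
  have hℓP : ℓ P = 0 := by simp only [ℓ, hPa, hpa]
  have hℓQ : ℓ Q = 0 := by simp only [ℓ, hQa, neg_mul, Complex.neg_re, hpa, neg_zero]
  have hsub : convexHull ℝ ({A, P, B, Q} : Set ℂ) ⊆ {X : ℂ | ℓ X ≤ normSq a} := by
    refine convexHull_min ?_ hH
    intro X hX
    simp only [mem_insert_iff, mem_singleton_iff] at hX
    simp only [mem_setOf_eq]
    rcases hX with rfl | rfl | rfl | rfl
    · rw [hℓA]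
    · rw [hℓP]; exact normSq_nonneg _
    · rw [hℓB]; linarith [normSq_nonneg a]
    · rw [hℓQ]; exact normSq_nonneg _
  -- an interior point would allow `A + δ a` in the hull
  intro hA
  rw [mem_interior_iff_mem_nhds, Metric.mem_nhds_iff] at hA
  obtain ⟨ε, hε, hεsub⟩ := hA
  have hapos : 0 < ‖a‖ := norm_pos_iff.2 ha0
  set δ : ℝ := ε / (2 * ‖a‖) with hδ
  have hδpos : 0 < δ := by positivity
  have hmem : A + (δ : ℂ) * a ∈ ball A ε := by
    rw [mem_ball, dist_eq_norm, add_sub_cancel_left, norm_mul, Complex.norm_real,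
      Real.norm_eq_abs, abs_of_pos hδpos, hδ, div_mul_eq_mul_div, mul_comm ε,
      mul_div_assoc]
    have : ‖a‖ * (ε / (2 * ‖a‖)) = ε / 2 := by field_simp
    rw [this]; linarith
  have hle := hsub (hεsub hmem)
  simp only [mem_setOf_eq, ℓ] at hle
  have : ((A + (δ : ℂ) * a - M) * conj a).re = (1 + δ) * normSq a := by
    have h' : A + (δ : ℂ) * a - M = ((1 + δ : ℝ) : ℂ) * a := by
      rw [← hAa]; push_cast; ring
    rw [h', mul_assoc, Complex.re_ofReal_mul, Complex.mul_conj, Complex.ofReal_re]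
  rw [this] at hle
  have hna : 0 < normSq a := normSq_pos.2 ha0
  nlinarith

end Quad

/-! ### Two segments whose open parts lie in disjoint open sets -/

section Segments

/-- **Segment bookkeeping.** If the open segments `(A, B)`, `(A', B')` lie in disjoint sets
`U`, `U'`, and no endpoint of either segment lies in the set containing the other open segment,
then the closed segments can only meet at a common endpoint. [folklore] -/
theorem segment_inter_segment_subset {A B A' B' : ℂ} {U U' : Set ℂ}
    (hU : openSegment ℝ A B ⊆ U) (hU' : openSegment ℝ A' B' ⊆ U') (hdisj : Disjoint U U')
    (hA : A ∉ U') (hB : B ∉ U') (hA' : A' ∉ U) (hB' : B' ∉ U) :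
    segment ℝ A B ∩ segment ℝ A' B' ⊆ ({A, B} ∩ {A', B'} : Set ℂ) := by
  rintro X ⟨hX, hX'⟩
  rcases Mesh.eq_or_eq_or_mem_openSegment hX with rfl | rfl | hXo <;>
    rcases Mesh.eq_or_eq_or_mem_openSegment hX' with h' | h' | hXo'
  · exact ⟨by simp, by simp [h']⟩
  · exact ⟨by simp, by simp [h']⟩
  · exact absurd (hU' hXo') hA
  · exact ⟨by simp, by simp [h']⟩
  · exact ⟨by simp, by simp [h']⟩
  · exact absurd (hU' hXo') hB
  · subst h'; exact absurd (hU hXo) hA'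
  · subst h'; exact absurd (hU hXo) hB'
  · exact absurd (hU hXo) (Set.disjoint_left.1 hdisj · (hU' hXo') |> fun h => h)

end Segments

/-! ### The rhombi of an isoradial rhombic tiling -/

section Emb

variable {V F : Type*} {G : SimpleGraph V} {emb : RhombicEmbedding G F}

/-- The rhombus of (the edge of) a dart, with its corners read off the dart: vertices
`A = z x`, `B = z y`, face centres `P = c (leftFace d)`, `Q = c (rightFace d)`.
(Grimmett–Manolescu 2014, §2.1.) [folklore] -/
theorem rhombus_dart_eq (hiso : emb.IsIsoradial) (d : G.Dart) :
    emb.rhombus ⟨d.edge, d.edge_mem⟩ = convexHull ℝ {emb.z d.fst, emb.c (emb.leftFace d),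
      emb.z d.snd, emb.c (emb.rightFace d)} :=
  emb.rhombus_eq_of_dart_edge hiso rfl

/-- The rhombus data of a dart: diagonals bisect each other, unit sides, non-degeneracy.
(Grimmett–Manolescu 2014, §2.1: "the quadrilateral `A O₁ B O₂` is a rhombus".) [folklore] -/
theorem dart_quad (hiso : emb.IsIsoradial) (d : G.Dart) :
    emb.c (emb.leftFace d) + emb.c (emb.rightFace d) = emb.z d.fst + emb.z d.snd ∧
      emb.z d.fst ≠ emb.z d.snd ∧ emb.c (emb.leftFace d) ≠ emb.c (emb.rightFace d) ∧
      ‖emb.z d.fst - emb.c (emb.leftFace d)‖ = 1 ∧ ‖emb.z d.snd - emb.c (emb.leftFace d)‖ = 1 :=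
  ⟨hiso.c_leftFace_add_c_rightFace d, fun h => d.fst_ne_snd (hiso.z_injective h),
    hiso.c_leftFace_ne d, (hiso.norm_sub_eq_one d).1, (hiso.norm_sub_eq_one d).2⟩

/-- **The open primal diagonal of an edge lies in the interior of its rhombus.**
(Grimmett–Manolescu 2014, §4.1: `e` is a diagonal of its rhombus.) [folklore] -/
theorem openSegment_z_subset_interior_rhombus (hiso : emb.IsIsoradial) (d : G.Dart) :
    openSegment ℝ (emb.z d.fst) (emb.z d.snd) ⊆ interior (emb.rhombus ⟨d.edge, d.edge_mem⟩) := by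
  obtain ⟨hsum, hAB, hPQ, hAP, hBP⟩ := dart_quad hiso d
  rw [rhombus_dart_eq hiso d]
  exact openSegment_subset_interior_convexHull_quad hsum hAB hPQ hAP hBP

/-- The corner set of a rhombus, listed from a face centre first. [folklore] -/
theorem quad_insert_comm (A P B Q : ℂ) : ({P, A, Q, B} : Set ℂ) = {A, P, B, Q} := by
  ext X; simp only [mem_insert_iff, mem_singleton_iff]; tauto

/-- In the rhombus of a dart the dual corner `Q` is at unit distance from `A` as well
(`A - Q = P - B`). [folklore] -/
theorem norm_z_fst_sub_c_rightFace (hiso : emb.IsIsoradial) (d : G.Dart) :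
    ‖emb.z d.fst - emb.c (emb.rightFace d)‖ = 1 := by
  obtain ⟨hsum, -, -, -, hBP⟩ := dart_quad hiso d
  have : emb.z d.fst - emb.c (emb.rightFace d) = emb.c (emb.leftFace d) - emb.z d.snd := by
    linear_combination (-1 : ℂ) * hsum
  rw [this, norm_sub_rev, hBP]

/-- **The open dual diagonal of an edge lies in the interior of its rhombus.**
(Grimmett–Manolescu 2014, §4.1: `e*` is the other diagonal of the rhombus of `e`.) [folklore] -/
theorem openSegment_c_subset_interior_rhombus (hiso : emb.IsIsoradial) (d : G.Dart) :
    openSegment ℝ (emb.c (emb.leftFace d)) (emb.c (emb.rightFace d)) ⊆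
      interior (emb.rhombus ⟨d.edge, d.edge_mem⟩) := by
  obtain ⟨hsum, hAB, hPQ, hAP, hBP⟩ := dart_quad hiso d
  rw [rhombus_dart_eq hiso d, ← quad_insert_comm]
  refine openSegment_subset_interior_convexHull_quad hsum.symm hPQ hAB ?_ ?_
  · rw [norm_sub_rev, hAP]
  · rw [norm_sub_rev]; exact norm_z_fst_sub_c_rightFace hiso d

/-- A vertex is not an interior point of the rhombus of one of its own edges. [folklore] -/
theorem z_fst_not_mem_interior_rhombus_self (hiso : emb.IsIsoradial) (d : G.Dart) :
    emb.z d.fst ∉ interior (emb.rhombus ⟨d.edge, d.edge_mem⟩) := by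
  obtain ⟨hsum, hAB, -, hAP, hBP⟩ := dart_quad hiso d
  rw [rhombus_dart_eq hiso d]
  exact not_mem_interior_convexHull_quad hsum hAB hAP hBP

/-- A face centre is not an interior point of the rhombus of one of its own edges. [folklore] -/
theorem c_leftFace_not_mem_interior_rhombus_self (hiso : emb.IsIsoradial) (d : G.Dart) :
    emb.c (emb.leftFace d) ∉ interior (emb.rhombus ⟨d.edge, d.edge_mem⟩) := by
  obtain ⟨hsum, hAB, hPQ, hAP, hBP⟩ := dart_quad hiso d
  rw [rhombus_dart_eq hiso d, ← quad_insert_comm]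
  refine not_mem_interior_convexHull_quad hsum.symm hPQ ?_ ?_
  · rw [norm_sub_rev, hAP]
  · rw [norm_sub_rev]; exact norm_z_fst_sub_c_rightFace hiso d

/-- Points of the open segment `(A, B)` come arbitrarily close to `A`. [folklore] -/
theorem exists_mem_openSegment_dist_lt (A B : ℂ) (hAB : A ≠ B) {ε : ℝ} (hε : 0 < ε) :
    ∃ Y ∈ openSegment ℝ A B, dist Y A < ε := by
  have hn : 0 < ‖B - A‖ := norm_pos_iff.2 (sub_ne_zero.2 hAB.symm)
  set θ : ℝ := min (1 / 2) (ε / (2 * ‖B - A‖)) with hθ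
  have hθpos : 0 < θ := by positivity
  have hθlt : θ < 1 := lt_of_le_of_lt (min_le_left _ _) (by norm_num)
  refine ⟨(1 - θ) • A + θ • B, ⟨1 - θ, θ, by linarith, hθpos, by ring, rfl⟩, ?_⟩
  rw [dist_eq_norm]
  have : (1 - θ) • A + θ • B - A = θ • (B - A) := by
    simp only [Complex.real_smul]; push_cast; ring
  rw [this, norm_smul, Real.norm_eq_abs, abs_of_pos hθpos]
  calc θ * ‖B - A‖ ≤ ε / (2 * ‖B - A‖) * ‖B - A‖ :=
        mul_le_mul_of_nonneg_right (min_le_right _ _) hn.le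
    _ = ε / 2 := by field_simp
    _ < ε := by linarith

/-- **Tiling: a corner of one rhombus is not interior to any rhombus.** If `X` is not an
interior point of the rhombus of `e₀` but is approached by interior points of it, then `X` is
not an interior point of the rhombus of any edge `e` (for `e ≠ e₀` the two interiors would
meet, against `IsRhombicTiling.disjoint_interior`). [folklore] -/
theorem not_mem_interior_rhombus_of_approach (hrh : emb.IsRhombicTiling) {X : ℂ}
    {e₀ : G.edgeSet} (h₀ : X ∉ interior (emb.rhombus e₀))
    (happ : ∀ ε > 0, ∃ Y ∈ interior (emb.rhombus e₀), dist Y X < ε) (e : G.edgeSet) :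
    X ∉ interior (emb.rhombus e) := by
  intro hX
  by_cases he : e₀ = e
  · exact h₀ (he ▸ hX)
  · obtain ⟨ε, hε, hsub⟩ := Metric.isOpen_iff.1 isOpen_interior X hX
    obtain ⟨Y, hY₀, hYX⟩ := happ ε hε
    have hY : Y ∈ interior (emb.rhombus e) := hsub (mem_ball.2 hYX)
    exact Set.disjoint_left.1 (hrh.disjoint_interior he) hY₀ hY

/-- **No vertex of `G` is an interior point of a rhombus** (the vertex being an endpoint of
some edge; isolated vertices are not located by the tiling). [folklore] -/
theorem z_fst_not_mem_interior_rhombus (hiso : emb.IsIsoradial) (hrh : emb.IsRhombicTiling)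
    (d : G.Dart) (e : G.edgeSet) : emb.z d.fst ∉ interior (emb.rhombus e) := by
  refine not_mem_interior_rhombus_of_approach hrh (z_fst_not_mem_interior_rhombus_self hiso d)
    (fun ε hε => ?_) e
  obtain ⟨Y, hY, hYd⟩ := exists_mem_openSegment_dist_lt _ _ (dart_quad hiso d).2.1 hε
  exact ⟨Y, openSegment_z_subset_interior_rhombus hiso d hY, hYd⟩

/-- **No face centre is an interior point of a rhombus.** [folklore] -/
theorem c_leftFace_not_mem_interior_rhombus (hiso : emb.IsIsoradial) (hrh : emb.IsRhombicTiling)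
    (d : G.Dart) (e : G.edgeSet) : emb.c (emb.leftFace d) ∉ interior (emb.rhombus e) := by
  refine not_mem_interior_rhombus_of_approach hrh
    (c_leftFace_not_mem_interior_rhombus_self hiso d) (fun ε hε => ?_) e
  obtain ⟨Y, hY, hYd⟩ := exists_mem_openSegment_dist_lt _ _ (dart_quad hiso d).2.2.1 hε
  exact ⟨Y, openSegment_c_subset_interior_rhombus hiso d hY, hYd⟩

/-- The same for the right face (reverse the dart). [folklore] -/
theorem c_rightFace_not_mem_interior_rhombus (hiso : emb.IsIsoradial)
    (hrh : emb.IsRhombicTiling) (d : G.Dart) (e : G.edgeSet) :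
    emb.c (emb.rightFace d) ∉ interior (emb.rhombus e) := by
  rw [← hiso.leftFace_symm]
  exact c_leftFace_not_mem_interior_rhombus hiso hrh d.symm e

/-- The rhombus of a dart only depends on its edge: reversing the dart does not change it.
[folklore] -/
theorem rhombus_dart_symm (d : G.Dart) :
    (⟨d.symm.edge, d.symm.edge_mem⟩ : G.edgeSet) = ⟨d.edge, d.edge_mem⟩ :=
  Subtype.ext d.edge_symm

/-! ### The straight-line drawing is a plane drawing -/

/-- **Plane drawing of `G`.** In an isoradial rhombic tiling, the closed straight edges of two
distinct edges of `G` meet at most at the position of a common endpoint: open diagonals lie in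
the disjoint interiors of the two rhombi, and no vertex is interior to a rhombus.
(Grimmett–Manolescu 2014, §4.1; Kenyon–Schlenker 2005, §1: the primal graph of a rhombic tiling
is a plane graph with straight edges.) [cite: GrimmettManolescu2014Isoradial, §4.1 (diamond graph and rhombic tiling)] -/
theorem segment_z_inter_segment_z_subset (hiso : emb.IsIsoradial) (hrh : emb.IsRhombicTiling)
    {d d' : G.Dart} (hne : d.edge ≠ d'.edge) :
    segment ℝ (emb.z d.fst) (emb.z d.snd) ∩ segment ℝ (emb.z d'.fst) (emb.z d'.snd) ⊆
      ({emb.z d.fst, emb.z d.snd} ∩ {emb.z d'.fst, emb.z d'.snd} : Set ℂ) := by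
  have hne' : (⟨d.edge, d.edge_mem⟩ : G.edgeSet) ≠ ⟨d'.edge, d'.edge_mem⟩ :=
    fun h => hne (congrArg Subtype.val h)
  refine segment_inter_segment_subset (openSegment_z_subset_interior_rhombus hiso d)
    (openSegment_z_subset_interior_rhombus hiso d') (hrh.disjoint_interior hne') ?_ ?_ ?_ ?_
  · exact z_fst_not_mem_interior_rhombus hiso hrh d _
  · exact z_fst_not_mem_interior_rhombus hiso hrh d.symm _
  · exact z_fst_not_mem_interior_rhombus hiso hrh d' _
  · exact z_fst_not_mem_interior_rhombus hiso hrh d'.symm _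

/-- **Plane drawing of the dual.** The closed dual edges (segments between the two face centres
of an edge) of two distinct edges meet at most at a common face centre.
(Grimmett–Manolescu 2014, §4.1: `G*` is embedded with vertices at the circumcentres.)
[cite: GrimmettManolescu2014Isoradial, §4.1 (the dual isoradial graph)] -/
theorem segment_c_inter_segment_c_subset (hiso : emb.IsIsoradial) (hrh : emb.IsRhombicTiling)
    {d d' : G.Dart} (hne : d.edge ≠ d'.edge) :
    segment ℝ (emb.c (emb.leftFace d)) (emb.c (emb.rightFace d)) ∩
        segment ℝ (emb.c (emb.leftFace d')) (emb.c (emb.rightFace d')) ⊆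
      ({emb.c (emb.leftFace d), emb.c (emb.rightFace d)} ∩
        {emb.c (emb.leftFace d'), emb.c (emb.rightFace d')} : Set ℂ) := by
  have hne' : (⟨d.edge, d.edge_mem⟩ : G.edgeSet) ≠ ⟨d'.edge, d'.edge_mem⟩ :=
    fun h => hne (congrArg Subtype.val h)
  refine segment_inter_segment_subset (openSegment_c_subset_interior_rhombus hiso d)
    (openSegment_c_subset_interior_rhombus hiso d') (hrh.disjoint_interior hne') ?_ ?_ ?_ ?_
  · exact c_leftFace_not_mem_interior_rhombus hiso hrh d _
  · exact c_rightFace_not_mem_interior_rhombus hiso hrh d _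
  · exact c_leftFace_not_mem_interior_rhombus hiso hrh d' _
  · exact c_rightFace_not_mem_interior_rhombus hiso hrh d' _

/-- **Primal edge versus the dual edge of another rhombus.** The closed primal edge of `d` and
the closed dual edge of `d'`, `d.edge ≠ d'.edge`, can only meet at a point that is both an
endpoint position of `d` and a face-centre position of `d'`. (Such coincidences are not
excluded by `IsIsoradial ∧ IsRhombicTiling` alone — see the module docstring; for the two
diagonals of the *same* rhombus the intersection is the centre.)
[cite: GrimmettManolescu2014Isoradial, §4.1 (e and e* are the diagonals of one rhombus)] -/
theorem segment_z_inter_segment_c_subset (hiso : emb.IsIsoradial) (hrh : emb.IsRhombicTiling)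
    {d d' : G.Dart} (hne : d.edge ≠ d'.edge) :
    segment ℝ (emb.z d.fst) (emb.z d.snd) ∩
        segment ℝ (emb.c (emb.leftFace d')) (emb.c (emb.rightFace d')) ⊆
      ({emb.z d.fst, emb.z d.snd} ∩ {emb.c (emb.leftFace d'), emb.c (emb.rightFace d')} :
        Set ℂ) := by
  have hne' : (⟨d.edge, d.edge_mem⟩ : G.edgeSet) ≠ ⟨d'.edge, d'.edge_mem⟩ :=
    fun h => hne (congrArg Subtype.val h)
  refine segment_inter_segment_subset (openSegment_z_subset_interior_rhombus hiso d)
    (openSegment_c_subset_interior_rhombus hiso d') (hrh.disjoint_interior hne') ?_ ?_ ?_ ?_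
  · exact z_fst_not_mem_interior_rhombus hiso hrh d _
  · exact z_fst_not_mem_interior_rhombus hiso hrh d.symm _
  · exact c_leftFace_not_mem_interior_rhombus hiso hrh d' _
  · exact c_rightFace_not_mem_interior_rhombus hiso hrh d' _

/-- **Open edges are disjoint from all other closed edges.** In particular a vertex position
never lies on the open straight edge of any edge, and two distinct open edges are disjoint.
[cite: GrimmettManolescu2014Isoradial, §4.1 (diamond graph and rhombic tiling)] -/
theorem openSegment_z_inter_segment_z_eq_empty (hiso : emb.IsIsoradial)
    (hrh : emb.IsRhombicTiling) {d d' : G.Dart} (hne : d.edge ≠ d'.edge) :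
    openSegment ℝ (emb.z d.fst) (emb.z d.snd) ∩ segment ℝ (emb.z d'.fst) (emb.z d'.snd) = ∅ := by
  rw [Set.eq_empty_iff_forall_notMem]
  rintro X ⟨hXo, hX'⟩
  have hXi := openSegment_z_subset_interior_rhombus hiso d hXo
  rcases Mesh.eq_or_eq_or_mem_openSegment hX' with rfl | rfl | hXo'
  · exact z_fst_not_mem_interior_rhombus hiso hrh d' _ hXi
  · exact z_fst_not_mem_interior_rhombus hiso hrh d'.symm _ hXi
  · have hne' : (⟨d.edge, d.edge_mem⟩ : G.edgeSet) ≠ ⟨d'.edge, d'.edge_mem⟩ :=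
      fun h => hne (congrArg Subtype.val h)
    exact Set.disjoint_left.1 (hrh.disjoint_interior hne') hXi
      (openSegment_z_subset_interior_rhombus hiso d' hXo')

/-- **A vertex lies on a closed edge only as an endpoint.** [cite: GrimmettManolescu2014Isoradial, §4.1 (diamond graph and rhombic tiling)] -/
theorem eq_or_eq_of_z_mem_segment (hiso : emb.IsIsoradial) (hrh : emb.IsRhombicTiling)
    (d d' : G.Dart) (h : emb.z d.fst ∈ segment ℝ (emb.z d'.fst) (emb.z d'.snd)) :
    d.fst = d'.fst ∨ d.fst = d'.snd := by
  rcases Mesh.eq_or_eq_or_mem_openSegment h with h | h | h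
  · exact Or.inl (hiso.z_injective h)
  · exact Or.inr (hiso.z_injective h)
  · exact absurd (openSegment_z_subset_interior_rhombus hiso d' h)
      (z_fst_not_mem_interior_rhombus hiso hrh d _)

end Emb

end Literature.Probability.Percolation

end
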